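import Summits.Langlands.Langlands.Statement
import Summits.Langlands.Langlands.Theorems.BaseFieldAscentAscentConjugationSolvableAscentHelpers
import Literature.NumberTheory.Automorphic.TunnellOctahedralGlobal
import Literature.NumberTheory.Automorphic.GaloisActionPlaces
import Literature.NumberTheory.Automorphic.AutomorphicRepsGLSatakeFlathProofs
import Literature.NumberTheory.GaloisRepresentations.FrobeniusStableExtension
import Literature.NumberTheory.GaloisRepresentations.FrobeniusPlaces
import Literature.NumberTheory.GaloisRepresentations.ResidualPairIntegrality
import Literature.NumberTheory.GaloisRepresentations.FramedRepTwist
import HarnessLib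

/-!
# Weak (A)-descent along a Galois layer of prime degree, REDUCED to the inert-place twist coherence
# (crux `AscentConjugationSolvable`, stmt-Langlands-1094; piece `CyclicPrimeDescent`, stmt-Langlands-18645,
# stub `stub_descentAutToGal`; lead c2 `--supports` helper, R-free)

Support file (closes nothing).  The open core of the conjugation-solvable ascent is direction (A) DOWN a
Galois layer `L/K` of prime degree (solvable NON-NORMAL base change: `K` need not be Galois over anything).
Its R-free, Satake-level residue was typed by the lead in `Cruxes/AscentConjugationSolvable/Atom.lean`
(`InertTwistCoherenceFor π P ι ρ₀`: if `P/L` is a weak base change of `π/K` and `ρ₀ : Γ_K → GL_n(ℚ̄_ℓ)` has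
irreducible restriction to `Γ_L` a.e. Satake–Frobenius compatible with `P`, then some twist `ρ₀ ⊗ χ`,
`χ|_{Γ_L} = 1`, is a.e. compatible with `π`), where it is proved NECESSARY (weak (A) over `K` implies it).
This file proves it SUFFICIENT, kernel-checked and free of reciprocity data and of named facts:

* `frobStable_of_isWeakBaseChangeLiftAE` — if `P` on `GL_n(𝔸_L)` is a weak base-change lift of `π` on
  `GL_n(𝔸_K)` (`L/K` Galois) and `ρ' : Γ_L → GL_n(ℚ̄_ℓ)` is a.e. Satake–Frobenius compatible with `P`, then
  the Frobenius characteristic polynomials of `ρ'` are `Gal(L/K)`-STABLE almost everywhere: at a.e. `w`,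
  `ρ'` has the same Frobenius polynomial at `w` and at `σ • w` — both are
  `∏ (X - ι⁻¹(α_j^{-f}))` for the Satake parameter `α` of `π` at `v = w ∩ K` (`f = f(w|v) = f(σw|v)`,
  `q_w = q_{σ w} = q_v^f`; Satake parameters exist a.e. and are unique — Flath, discharged in tree).
* `exists_satakeFrobCompatible_descent_of_inertTwistCoherence` — **the reduction**: for `L/K` Galois of
  PRIME degree, `P` a weak base change of `π`, `ρ'` IRREDUCIBLE and a.e. compatible with `P`, and the atom
  for `(π, P)` (for every `ρ₀` with irreducible restriction a.e. compatible with `P`), there is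
  `ρ : Γ_K → GL_n(ℚ̄_ℓ)` a.e. Satake–Frobenius compatible with `π`.  Proof: `Gal(L/K)` is cyclic (prime
  order); `ρ'` is unramified a.e. (compatibility) with `Gal(L/K)`-stable Frobenius polynomials (previous
  theorem), so it EXTENDS to some `ρ₀` over `K` with `ρ₀|_{Γ_L} = ρ'` (landed
  `FramedGaloisRep.exists_restrictField_eq_of_frobStable`, p156869: Chebotarev + Brauer–Nesbitt give
  `ρ'^τ ≅ ρ'`, Schur + `H²(ℤ/p, ℚ̄_ℓ^×)`-triviality give the extension); the atom turns `ρ₀` into a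
  compatible twist `ρ₀ ⊗ χ`.

So, for a cuspidal L-algebraic `π/K` whose weak base change `P/L` carries an irreducible compatible `ρ'`
(e.g. `P` cuspidal and reciprocity over `L`), weak (A) over `K` for `π` ⟺ the atom for `(π, P)`
(`⟸` here, `⟹` in `Atom.lean :: inertTwistCoherenceFor_of_weakAutToGal`).  What is NOT here: the
`π ≅ π ⊗ η` case (`P` not cuspidal; `ρ_π` is then INDUCED from `L` — `FramedGaloisRep.induce`,
`hasFrobCharpolyAt_induce` — and carries no atom), local–global compatibility at the finite places, and the
production of `ReciprocityData K` (stmt-Langlands-17930).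

References: J. Arthur, L. Clozel, Ann. of Math. Stud. 120 (1989), Ch. 3 Thm. 4.2 and §7 (closing remark);
H. Jacquet, I. Piatetski-Shapiro, J. Shalika, C. R. Acad. Sci. 292 (1981); C. S. Rajan, Math. Res. Lett. 9
(2002); D. Flath, Corvallis (1979), Thm. 3; J.-P. Serre, *Abelian ℓ-adic representations* (1968), Ch. I §2.
-/

noncomputable section

set_option linter.dupNamespace false -- project-wide option; `Summit.Langlands.Langlands` is the mandated namespace

namespace Summit.Langlands.Langlands.Theorems.SmithKummerSeedCyclicPrimeDescent

open scoped MatrixGroups NumberField Classical Matrix Polynomial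
open Filter IsDedekindDomain Field Polynomial
open Literature.NumberTheory.Automorphic Literature.NumberTheory.GaloisRepresentations
open Summit.Langlands

variable {K L : Type} [Field K] [NumberField K] [Field L] [NumberField L] [Algebra K L]
  {n : ℕ} {ℓ : ℕ} [Fact ℓ.Prime]

/-- **A weak base change has `Gal(L/K)`-stable Frobenius polynomials on every compatible Galois
representation.**  Let `L/K` be Galois, `P` on `GL_n(𝔸_L)` a weak base-change lift of `π` on `GL_n(𝔸_K)`
(`IsWeakBaseChangeLiftAE`: `Sat(P_w) = Sat(π_v)^{f(w|v)}` a.e.), and `ρ' : Γ_L → GL_n(ℚ̄_ℓ)` Satake–Frobenius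
compatible with `P` at almost every place.  Then for every `σ ∈ Gal(L/K)`, at almost every `w` the Frobenius
characteristic polynomials of `ρ'` at `w` and at `σ • w` coincide (both are the Satake polynomial of
`Sat(π_v)^f`, `q_w = q_{σ w} = q_v^f`). [cite: ArthurClozelAMS120, Ch. 3 (1.1) and Lemma 1.3] -/
theorem frobStable_of_isWeakBaseChangeLiftAE [IsGalois K L] {hK : isCompact_glFiniteIntegralLevel n K}
    {hL : isCompact_glFiniteIntegralLevel n L} (ι : PadicAlgCl ℓ ≃+* ℂ)
    (π : AutomorphicRepData (AutomorphyDatum.gl n K hK)) (P : AutomorphicRepData (AutomorphyDatum.gl n L hL))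
    (hBC : IsWeakBaseChangeLiftAE π P) (ρ' : FramedGaloisRep L (PadicAlgCl ℓ) n)
    (h : ∀ᶠ w : HeightOneSpectrum (𝓞 L) in cofinite, SatakeFrobCompatibleAt ι P ρ' w)
    (σ : L ≃ₐ[K] L) :
    ∀ᶠ w : HeightOneSpectrum (𝓞 L) in cofinite,
      ∃ Q : (PadicAlgCl ℓ)[X], ρ'.HasFrobCharpolyAt w Q ∧ ρ'.HasFrobCharpolyAt (σ • w) Q := by
  -- good places `v` of `K`: every `w ∣ v` carries compatibility and the base-change relation, and `π`
  -- has a Satake parameter at `v` (Flath: a.e.)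
  have hgood := (eventually_forall_under_eq (F := K) (h.and hBC)).and
    (AutomorphicRepData.hasSatakeParamAt_cofinite_holds π)
  refine (eventually_under (E := L) hgood).mono fun w hw => ?_
  obtain ⟨hall, α, hα⟩ := hw (w.under (𝓞 K)) rfl
  have hwv : w.asIdeal.under (𝓞 K) = (w.under (𝓞 K)).asIdeal := rfl
  have hσwv : (σ • w).asIdeal.under (𝓞 K) = (w.under (𝓞 K)).asIdeal :=
    congrArg HeightOneSpectrum.asIdeal
      (HeightOneSpectrum.under_algEquiv_smul (F := K) (E := L) (σ := σ) (w := w))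
  -- the Frobenius polynomial of `ρ'` at any `w'' ∣ v` in the good set is the Satake polynomial of `α^f`
  have key : ∀ w'' : HeightOneSpectrum (𝓞 L), w''.asIdeal.under (𝓞 K) = (w.under (𝓞 K)).asIdeal →
      ρ'.HasFrobCharpolyAt w'' (arithFrobPolyOfSatake ι
        ((w.under (𝓞 K)).residueCard ^ w''.asIdeal.inertiaDeg (𝓞 K)) 1
          (α.map (· ^ w''.asIdeal.inertiaDeg (𝓞 K)))) := by
    intro w'' hw''
    obtain ⟨⟨β, hβ, -, hc⟩, hbc⟩ := hall w'' hw''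
    obtain rfl : β = α.map (· ^ w''.asIdeal.inertiaDeg (𝓞 K)) :=
      AutomorphicRepData.hasSatakeParamAt_unique_holds P hβ (hbc _ α hw'' hα)
    rwa [residueCard_eq_residueCard_pow_inertiaDeg hw''] at hc
  refine ⟨_, key w hwv, ?_⟩
  have e := key (σ • w) hσwv
  rwa [HeightOneSpectrum.inertiaDeg_algEquiv_smul (F := K) (E := L) (σ := σ) (w := w)] at e

/-- **The (A)-descent along a Galois layer of prime degree, reduced to the inert-place twist coherence.**
Let `L/K` be Galois of PRIME degree, `P/L` a weak base change of `π/K`, `ρ' : Γ_L → GL_n(ℚ̄_ℓ)` irreducible and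
a.e. Satake–Frobenius compatible with `P`, and assume the ATOM for `(π, P)`: every `ρ₀ : Γ_K → GL_n(ℚ̄_ℓ)` with
irreducible restriction to `Γ_L` a.e. compatible with `P` has a twist `ρ₀ ⊗ χ` (`χ` trivial on `Γ_L`) a.e.
compatible with `π` (`Cruxes/AscentConjugationSolvable/Atom.lean :: InertTwistCoherenceFor`).  Then some
`ρ : Γ_K → GL_n(ℚ̄_ℓ)` is a.e. Satake–Frobenius compatible with `π`.  (`Gal(L/K)` is cyclic; `ρ'` is unramified
a.e. with `Gal(L/K)`-stable Frobenius polynomials, `frobStable_of_isWeakBaseChangeLiftAE`, hence extends to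
`Γ_K`, `FramedGaloisRep.exists_restrictField_eq_of_frobStable`; the atom twists the extension into place.)
[cite: ArthurClozelAMS120, Ch. 3 Thm. 4.2 and §7] -/
theorem exists_satakeFrobCompatible_descent_of_inertTwistCoherence [IsGalois K L]
    (hp : (Module.finrank K L).Prime) {hK : isCompact_glFiniteIntegralLevel n K}
    {hL : isCompact_glFiniteIntegralLevel n L} (ι : PadicAlgCl ℓ ≃+* ℂ)
    (π : AutomorphicRepData (AutomorphyDatum.gl n K hK)) (P : AutomorphicRepData (AutomorphyDatum.gl n L hL))
    (hBC : IsWeakBaseChangeLiftAE π P) (ρ' : FramedGaloisRep L (PadicAlgCl ℓ) n)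
    (hirr : ρ'.toGaloisRep.IsIrreducible)
    (hρ' : ∀ᶠ w : HeightOneSpectrum (𝓞 L) in cofinite, SatakeFrobCompatibleAt ι P ρ' w)
    (hAtom : ∀ ρ₀ : FramedGaloisRep K (PadicAlgCl ℓ) n,
      (ρ₀.restrictField L).toGaloisRep.IsIrreducible →
        (∀ᶠ w : HeightOneSpectrum (𝓞 L) in cofinite, SatakeFrobCompatibleAt ι P (ρ₀.restrictField L) w) →
          ∃ χ : absoluteGaloisGroup K →ₜ* (PadicAlgCl ℓ)ˣ,
            (∀ τ : absoluteGaloisGroup L, χ (absGaloisRestrict K L τ) = 1) ∧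
              ∀ᶠ v : HeightOneSpectrum (𝓞 K) in cofinite, SatakeFrobCompatibleAt ι π (ρ₀.twist χ) v) :
    ∃ ρ : FramedGaloisRep K (PadicAlgCl ℓ) n,
      ∀ᶠ v : HeightOneSpectrum (𝓞 K) in cofinite, SatakeFrobCompatibleAt ι π ρ v := by
  haveI : FiniteDimensional K L := Module.Finite.of_restrictScalars_finite ℚ K L
  haveI : IsCyclic (L ≃ₐ[K] L) :=
    BaseFieldAscentAscentConjugationSolvable.isCyclic_algEquiv_of_finrank_prime K L hp
  have hunr : ∀ᶠ w : HeightOneSpectrum (𝓞 L) in cofinite, ρ'.IsUnramifiedAt w :=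
    hρ'.mono fun w ⟨_, _, hur, _⟩ => hur
  obtain ⟨ρ₀, hρ₀⟩ := FramedGaloisRep.exists_restrictField_eq_of_frobStable ρ' hirr hunr
    (frobStable_of_isWeakBaseChangeLiftAE ι π P hBC ρ' hρ')
  obtain ⟨χ, -, hχ⟩ := hAtom ρ₀ (hρ₀ ▸ hirr) (hρ₀ ▸ hρ')
  exact ⟨ρ₀.twist χ, hχ⟩

/-- **Registered stub `frobStable_of_weakBaseChange` of crux stmt-Langlands-1094 (lead c2), closed form of
`frobStable_of_isWeakBaseChangeLiftAE`**: along a Galois `L/K`, a Galois representation a.e. compatible with a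
weak base change of `π` has `Gal(L/K)`-stable Frobenius polynomials almost everywhere.
[cite: ArthurClozelAMS120, Ch. 3 (1.1) and Lemma 1.3] -/
theorem frobStable_of_weakBaseChange : ∀ (K L : Type) [Field K] [NumberField K] [Field L] [NumberField L] [Algebra K L] [IsGalois K L] (n : ℕ) (hK : Literature.NumberTheory.Automorphic.isCompact_glFiniteIntegralLevel n K) (hL : Literature.NumberTheory.Automorphic.isCompact_glFiniteIntegralLevel n L) (ℓ : ℕ) [Fact ℓ.Prime] (ι : PadicAlgCl ℓ ≃+* ℂ) (π : Literature.NumberTheory.Automorphic.AutomorphicRepData (Literature.NumberTheory.Automorphic.AutomorphyDatum.gl n K hK)) (P : Literature.NumberTheory.Automorphic.AutomorphicRepData (Literature.NumberTheory.Automorphic.AutomorphyDatum.gl n L hL)), Literature.NumberTheory.Automorphic.IsWeakBaseChangeLiftAE π P → ∀ (ρ' : Literature.NumberTheory.GaloisRepresentations.FramedGaloisRep L (PadicAlgCl ℓ) n), (∀ᶠ w : IsDedekindDomain.HeightOneSpectrum (NumberField.RingOfIntegers L) in cofinite, SatakeFrobCompatibleAt ι P ρ' w) → ∀ σ : L ≃ₐ[K]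 L, ∀ᶠ w : IsDedekindDomain.HeightOneSpectrum (NumberField.RingOfIntegers L) in cofinite, ∃ Q : Polynomial (PadicAlgCl ℓ), ρ'.HasFrobCharpolyAt w Q ∧ ρ'.HasFrobCharpolyAt (σ • w) Q :=
  fun _ _ _ _ _ _ _ _ _ _ _ _ _ ι π P hBC ρ' h σ => frobStable_of_isWeakBaseChangeLiftAE ι π P hBC ρ' h σ

/-- **Registered stub `descent_of_inertTwistCoherence` of crux stmt-Langlands-1094 (lead c2), closed form of
`exists_satakeFrobCompatible_descent_of_inertTwistCoherence`**: along a Galois layer of PRIME degree, the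
inert-place twist coherence (the atom of `Cruxes/AscentConjugationSolvable/Atom.lean`) turns an irreducible
Galois representation compatible with a weak base change of `π` into a Galois representation over `K`
compatible with `π` — the weak (A)-descent, reduced to the atom. [cite: ArthurClozelAMS120, Ch. 3 Thm. 4.2 and §7] -/
theorem descent_of_inertTwistCoherence : ∀ (K L : Type) [Field K] [NumberField K] [Field L] [NumberField L] [Algebra K L] [IsGalois K L], (Module.finrank K L).Prime → ∀ (n : ℕ) (hK : Literature.NumberTheory.Automorphic.isCompact_glFiniteIntegralLevel n K) (hL : Literature.NumberTheory.Automorphic.isCompact_glFiniteIntegralLevel n L) (ℓ : ℕ) [Fact ℓ.Prime] (ι : PadicAlgCl ℓ ≃+* ℂ) (π : Literature.NumberTheory.Automorphic.AutomorphicRepData (Literature.NumberTheory.Automorphic.AutomorphyDatum.gl n K hK)) (P : Literature.NumberTheory.Automorphic.AutomorphicRepData (Literature.NumberTheory.Automorphic.AutomorphyDatum.gl n L hL)), Literature.NumberTheory.Automorphic.IsWeakBaseChangeLiftAE π P → ∀ (ρ' : Literature.NumberTheory.GaloisRepresentations.FramedGaloisRep L (PadicAlgCl ℓ) n), ρ'.toGaloisRep.IsIrreducible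 → (∀ᶠ w : IsDedekindDomain.HeightOneSpectrum (NumberField.RingOfIntegers L) in cofinite, SatakeFrobCompatibleAt ι P ρ' w) → (∀ ρ₀ : Literature.NumberTheory.GaloisRepresentations.FramedGaloisRep K (PadicAlgCl ℓ) n, (ρ₀.restrictField L).toGaloisRep.IsIrreducible → (∀ᶠ w : IsDedekindDomain.HeightOneSpectrum (NumberField.RingOfIntegers L) in cofinite, SatakeFrobCompatibleAt ι P (ρ₀.restrictField L) w) → ∃ χ : Field.absoluteGaloisGroup K →ₜ* (PadicAlgCl ℓ)ˣ, (∀ τ : Field.absoluteGaloisGroup L, χ (Literature.NumberTheory.GaloisRepresentations.absGaloisRestrict K L τ) = 1) ∧ ∀ᶠ v : IsDedekindDomain.HeightOneSpectrum (NumberField.RingOfIntegers K) in cofinite, SatakeFrobCompatibleAt ι π (ρ₀.twist χ) v) → ∃ ρ : Literature.NumberTheory.GaloisRepresentations.FramedGaloisRep K (PadicAlgCl ℓ) n, ∀ᶠ v : IsDedekindDomain.HeightOneSpectrum (NumberField.RingOfIntegers K) in cofinite, SatakeFrobCompatibleAt ι π ρ v :=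
  fun _ _ _ _ _ _ _ _ hp _ _ _ _ _ ι π P hBC ρ' hirr hρ' hAtom =>
    exists_satakeFrobCompatible_descent_of_inertTwistCoherence hp ι π P hBC ρ' hirr hρ' hAtom

end Summit.Langlands.Langlands.Theorems.SmithKummerSeedCyclicPrimeDescent

end
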